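import Summits.HodgeConjecture.HodgeConjecture.Theorems.F0P3cStCharTSTorusDefs         -- ★ p849564 the TERMS OF RECORD: `torusChart`, `torusChartHom`, `vanDijkWeight`, `torusTransform`, …
import Literature.NumberTheory.Automorphic.CMPrincipalSeriesJacquetEvalOne           -- ★ `continuous_torusEntry`, `continuous_torusDetNormOne`
import Literature.NumberTheory.Automorphic.CMPrincipalSeriesSpherical                -- ★ `mem_cmLocalIntegralLevel_iff_forall_v_le_one`
import Literature.NumberTheory.Automorphic.AnisotropicUnitaryGroupCompactOfPlace    -- ★ `conjLocal_apply_eq_of_smul_eq`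
import Literature.NumberTheory.Automorphic.GaloisActionPlaces                       -- ★ `valued_galAdicCompletionMap`
import HarnessLib

/-!
# F0 · P3c · line LH6 «StCharTS» — «CHART-ISO★» + P5 «HAAR TRANSPORT»: the torus chart `ι : E_vˣ × E¹_v ≃ₜ* T` is a topological group isomorphism;
# Haar measures and integrals transport along it; `ι⁻¹(T ∩ K_v) = M_c`  [Rogawski1990, §12.2 p. 173 («`M ≅ E* × E¹`»); §12.7 L. 12.7.2 (proof) p. 193]

Cell `pub/hodgecm-mathlib`, crux H413 = `stmt-HodgeConjecture-24833` (`--supports` lane), route HCCMUnconditional; seat LH6-p01 (g2), integrator of the (TOR) discharge road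
(desk F0P3b-plan (g23) 05:28:37Z); census of record `F0/P3b/LH6-p01/g2/CENSUS-PSM.v2-TERMS.md` items P1 + P5.  ONE `def` (`torusChartEquiv`, the `≃ₜ*` packaging of ★
`torusChart`) + theorems; no instance ∕ notation ∕ sorry ∕ named fact.  WHAT «PSM★» CONSUMES FROM HERE: (i) `torusChartEquiv` (so ★ Mathlib `ContinuousMulEquiv.isHaarMeasure_map`
makes `ι_* μM` a Haar measure on `T`, the `μ_T` of ★ `smoothTrace_cmPrincipalSeries_map_symm_eq_inv_mul_integral`); (ii) `integral_comp_torusChart` (`∫_T f d(ι_*μM) = ∫_M f ∘ ι dμM`);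
(iii) `torusChart_mem_cmLocalIntegralLevel_iff` (`ι m ∈ K_v ↔ m ∈ M_c`, non-split `v`) and its measure form `map_torusChart_real_level_eq` (`(ι_*μM)(T ∩ K_v) = μM(M_c)`, the
calibration constant of the torus transform ★ `torusTransform`).
HONEST LABEL: HC_CM is proved only modulo the 7 printed citations (2 remaining: hLiu418 = stmt-HodgeConjecture-24832, h413 = stmt-HodgeConjecture-24833) until rung 0 closes;
count-neutral structure.

## References
* [Rogawski1990] J. D. Rogawski, *Automorphic Representations of Unitary Groups in Three Variables*, Ann. of Math. Stud. 123 (1990): §1.10 p. 9; §12.2 p. 173; §12.7 L. 12.7.2 (proof) p. 193.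
* [PlatonovRapinchuk1994] V. Platonov, A. Rapinchuk, *Algebraic Groups and Number Theory* (1994), §5.1 (one place above a non-split `v`).
-/

set_option autoImplicit false
-- the mandated namespace has the single-problem summit's repeated segment (`HodgeConjecture.HodgeConjecture`)
set_option linter.dupNamespace false

noncomputable section

open NumberField IsDedekindDomain MeasureTheory Topology
open scoped Matrix MatrixGroups
open Literature.NumberTheory.Rogawski1990 Literature.NumberTheory.Automorphic Literature.NumberTheory.Automorphic.UnitaryGroup
open Summit.HodgeConjecture.HodgeConjecture.Cruxes.H413.F0P3cStCharTSTorusDefs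
open Summit.HodgeConjecture.HodgeConjecture.Cruxes.H413.F0P3cStCharTSTorusCompactPart

namespace Summit.HodgeConjecture.HodgeConjecture.Cruxes.H413.F0P3cStCharTSTorusChartIso

variable (L : Type) [Field L] [NumberField L] [IsCMField L] (v : HeightOneSpectrum (𝓞 ↥(maximalRealSubfield L)))

/-! ## §1 Continuity of the chart -/

omit [IsCMField L] in
/-- `d ↦ diag(d) : (Fin 3 → E_vˣ) → GL₃(E_v)` is continuous (entries and inverse entries are continuous). [folklore] -/
theorem continuous_glDiagonal_three : Continuous fun d : Fin 3 → (LocalRing L v)ˣ => glDiagonal 3 (LocalRing L v) d := by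
  refine Units.continuous_iff.2 ⟨?_, ?_⟩
  · refine (Continuous.matrix_diagonal (continuous_pi fun k => Units.continuous_val.comp (continuous_apply k)) :
      Continuous fun d : Fin 3 → (LocalRing L v)ˣ => Matrix.diagonal fun k => ((d k : (LocalRing L v)ˣ) : LocalRing L v)).congr fun d => ?_
    exact (coe_glDiagonal _ _ d).symm
  · refine (Continuous.matrix_diagonal (continuous_pi fun k => Units.continuous_coe_inv.comp (continuous_apply k)) :
      Continuous fun d : Fin 3 → (LocalRing L v)ˣ => Matrix.diagonal fun k => (((d k)⁻¹ : (LocalRing L v)ˣ) : LocalRing L v)).congr fun d => ?_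
    show (Matrix.diagonal fun k => (((d k)⁻¹ : (LocalRing L v)ˣ) : LocalRing L v)) = Units.val (glDiagonal 3 (LocalRing L v) d)⁻¹
    rw [← map_inv, coe_glDiagonal]
    rfl

/-- The chart entries `(α, z σ(α) α⁻¹, σ(α)⁻¹)` depend continuously on `(α, z)`. [cite: Rogawski1990, §12.2 p. 173] -/
theorem continuous_torusChartEntries : Continuous (torusChartEntries L v) := by
  have hσ : Continuous (Units.map ((conjLocal L (IsCMField.complexConj L) v : LocalRing L v →+* LocalRing L v) : LocalRing L v →* LocalRing L v)) :=
    Continuous.units_map _ (continuous_conjLocal L (IsCMField.complexConj L) v)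
  refine continuous_pi fun i => ?_
  fin_cases i
  · exact continuous_fst
  · exact ((continuous_subtype_val.comp continuous_snd).mul (hσ.comp continuous_fst)).mul continuous_fst.inv
  · exact (hσ.comp continuous_fst).inv

/-- **The torus chart `ι : E_vˣ × E¹_v → T` is continuous.** [cite: Rogawski1990, §12.2 p. 173] -/
theorem continuous_torusChart : Continuous (torusChart L v) :=
  ((continuous_glDiagonal_three L v).comp (continuous_torusChartEntries L v)).subtype_mk _ |>.subtype_mk _

/-! ## §2 The inverse chart `t ↦ (t₀₀, det t)` and the topological group isomorphism -/

/-- The inverse chart `T → E_vˣ × E¹_v`, `t ↦ (t₀₀, det t)` (★ `torusEntry 0`, ★ `torusDetNormOne`). [cite: Rogawski1990, §12.2 p. 173; §12.1 p. 171] -/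
def torusCoords (t : ↥(cmBorelTriple L 3 v).M) : (LocalRing L v)ˣ × ↥(normOneUnits (conjLocal L (IsCMField.complexConj L) v)) :=
  (torusEntry (conjLocal L (IsCMField.complexConj L) v) (cmLocalForm L 3 v) 0 t,
    torusDetNormOne (conjLocal L (IsCMField.complexConj L) v) (cmLocalForm L 3 v) (cmLocalForm_eq_over L 3 v) t)

/-- `coords (ι m) = m`. [cite: Rogawski1990, §12.2 p. 173] -/
theorem torusCoords_torusChart (m : (LocalRing L v)ˣ × ↥(normOneUnits (conjLocal L (IsCMField.complexConj L) v))) :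
    torusCoords L v (torusChart L v m) = m :=
  Prod.ext (torusEntry_zero_torusChart L v m) (torusDetNormOne_torusChart L v m)

/-- `ι (coords t) = t`: a torus element `d(d₀, d₁, d₂)` is recovered from `(d₀, det)` through the torus relations `σ(d₂) d₀ = 1`, `σ(d₀) d₂ = 1` (★
`glDiagonal_mem_unitaryGroupOfForm_antidiagonal_iff`): `d₂ = σ(d₀)⁻¹`, `d₁ = det · σ(d₀) · d₀⁻¹`. [cite: Rogawski1990, §1.10 p. 9; §12.2 p. 173] -/
theorem torusChart_torusCoords (t : ↥(cmBorelTriple L 3 v).M) : torusChart L v (torusCoords L v t) = t := by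
  obtain ⟨d, hd⟩ := (mem_torusU_iff _).1 t.2
  -- the torus relations, at unit level
  set σu : (LocalRing L v)ˣ →* (LocalRing L v)ˣ :=
    Units.map ((conjLocal L (IsCMField.complexConj L) v : LocalRing L v →+* LocalRing L v) : LocalRing L v →* LocalRing L v) with hσu
  have hmem : glDiagonal 3 (LocalRing L v) d ∈ unitaryGroupOfForm (conjLocal L (IsCMField.complexConj L) v) ((StdForm.antidiagonal 3).over (LocalRing L v)) := by
    rw [← cmLocalForm_eq_over L 3 v, hd]; exact (t : ↥(unitaryGroupOfForm (conjLocal L (IsCMField.complexConj L) v) (cmLocalForm L 3 v))).2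
  have hrel := (glDiagonal_mem_unitaryGroupOfForm_antidiagonal_iff (conjLocal L (IsCMField.complexConj L) v) 3 d).1 hmem
  have hrelu : ∀ i : Fin 3, σu (d (Fin.rev i)) * d i = 1 := fun i => by
    apply Units.ext
    rw [Units.val_mul, hσu, Units.coe_map, MonoidHom.coe_coe, Units.val_one]
    exact hrel i
  have h2 : σu (d 0) = (d 2)⁻¹ := by
    have := hrelu 2
    rw [show (Fin.rev 2 : Fin 3) = 0 from by decide] at this
    exact eq_inv_of_mul_eq_one_left this
  -- the coordinates of `t`
  have hc0 : (torusCoords L v t).1 = d 0 := torusEntry_eq_of_glDiagonal_eq _ _ 0 t d hd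
  have hc1 : ((torusCoords L v t).2 : (LocalRing L v)ˣ) = d 0 * d 1 * d 2 := by
    show ((torusDetNormOne (conjLocal L (IsCMField.complexConj L) v) (cmLocalForm L 3 v) (cmLocalForm_eq_over L 3 v) t :
      ↥(normOneUnits (conjLocal L (IsCMField.complexConj L) v))) : (LocalRing L v)ˣ) = d 0 * d 1 * d 2
    rw [coe_torusDetNormOne, torusDet_eq_of_glDiagonal_eq _ _ t d hd, Fin.prod_univ_three]
  -- compare diagonals entrywise
  apply Subtype.ext; apply Subtype.ext
  rw [coe_torusChart, ← hd]
  congr 1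
  funext i
  fin_cases i
  · exact hc0
  · show ((torusCoords L v t).2 : (LocalRing L v)ˣ) * σu (torusCoords L v t).1 * ((torusCoords L v t).1)⁻¹ = d 1
    rw [hc1, hc0, h2]
    have hre : d 0 * d 1 * d 2 * (d 2)⁻¹ * (d 0)⁻¹ = d 1 * (d 2 * (d 2)⁻¹) * (d 0 * (d 0)⁻¹) := by ac_rfl
    rw [hre, mul_inv_cancel, mul_inv_cancel, mul_one, mul_one]
  · show (σu (torusCoords L v t).1)⁻¹ = d 2
    rw [hc0, h2, inv_inv]

/-- **THE TORUS CHART AS A TOPOLOGICAL GROUP ISOMORPHISM `ι : E_vˣ × E¹_v ≃ₜ* T`** (print's `M ≅ E* × E¹`): the ★ `torusChartHom` with its continuous inverse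
`t ↦ (t₀₀, det t)`. [cite: Rogawski1990, §12.2 p. 173] -/
def torusChartEquiv : ((LocalRing L v)ˣ × ↥(normOneUnits (conjLocal L (IsCMField.complexConj L) v))) ≃ₜ* ↥(cmBorelTriple L 3 v).M :=
  { torusChartHom L v with
    invFun := torusCoords L v
    left_inv := torusCoords_torusChart L v
    right_inv := torusChart_torusCoords L v
    continuous_toFun := continuous_torusChart L v
    continuous_invFun :=
      (continuous_torusEntry (conjLocal L (IsCMField.complexConj L) v) (cmLocalForm L 3 v) 0).prodMk
        (continuous_torusDetNormOne (conjLocal L (IsCMField.complexConj L) v) (cmLocalForm L 3 v) (cmLocalForm_eq_over L 3 v)) }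

/-- `torusChartEquiv` IS `torusChart` (`rfl`). [cite: Rogawski1990, §12.2 p. 173] -/
@[simp] theorem torusChartEquiv_apply (m : (LocalRing L v)ˣ × ↥(normOneUnits (conjLocal L (IsCMField.complexConj L) v))) :
    torusChartEquiv L v m = torusChart L v m := rfl

/-- `⇑torusChartEquiv = torusChart` (`rfl`). [cite: Rogawski1990, §12.2 p. 173] -/
theorem coe_torusChartEquiv : ⇑(torusChartEquiv L v) = torusChart L v := rfl

/-- The chart is a bijection. [cite: Rogawski1990, §12.2 p. 173] -/
theorem torusChart_bijective : Function.Bijective (torusChart L v) := (torusChartEquiv L v).bijective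

/-! ## §3 P5 «HAAR TRANSPORT» along the chart -/

section Haar

variable [MeasurableSpace ((LocalRing L v)ˣ × ↥(normOneUnits (conjLocal L (IsCMField.complexConj L) v)))]
  [BorelSpace ((LocalRing L v)ˣ × ↥(normOneUnits (conjLocal L (IsCMField.complexConj L) v)))]
  [MeasurableSpace ↥(unitaryGroupOfForm (conjLocal L (IsCMField.complexConj L) v) (cmLocalForm L 3 v))]
  [BorelSpace ↥(unitaryGroupOfForm (conjLocal L (IsCMField.complexConj L) v) (cmLocalForm L 3 v))]

/-- **`ι_* μM` is a Haar measure on `T`** for every Haar measure `μM` on `E_vˣ × E¹_v` (Mathlib `ContinuousMulEquiv.isHaarMeasure_map`). [cite: Rogawski1990, §12.2 p. 173] -/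
theorem isHaarMeasure_map_torusChart (μM : Measure ((LocalRing L v)ˣ × ↥(normOneUnits (conjLocal L (IsCMField.complexConj L) v))))
    [μM.IsHaarMeasure] : (μM.map (torusChart L v)).IsHaarMeasure := by
  rw [← coe_torusChartEquiv]
  infer_instance

/-- **Change of variables along the chart**: `∫_T f d(ι_* μM) = ∫_M f ∘ ι dμM` (no measurability of `f` needed: `ι` is a homeomorphism, hence a measurable embedding).
[cite: Rogawski1990, §12.7 L. 12.7.2 (proof) p. 193] -/
theorem integral_comp_torusChart (μM : Measure ((LocalRing L v)ˣ × ↥(normOneUnits (conjLocal L (IsCMField.complexConj L) v))))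
    (f : ↥(cmBorelTriple L 3 v).M → ℂ) :
    ∫ t, f t ∂(μM.map (torusChart L v)) = ∫ m, f (torusChart L v m) ∂μM := by
  rw [← coe_torusChartEquiv]
  exact (torusChartEquiv L v).toHomeomorph.measurableEmbedding.integral_map f

end Haar

/-! ## §4 `ι⁻¹(T ∩ K_v) = M_c` at a non-split place -/

variable (hns : ∀ w : PlacesOver L v, IsCMField.complexConj L • w.1 = w.1)

include hns in
/-- **`ι(α, z) ∈ K_v = U(Φ₃)(𝒪_v)` iff `(α, z) ∈ M_c = 𝒪_vˣ × E¹_v`** (non-split `v`): a diagonal unitary matrix is integral with integral inverse iff its entries are units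
of `𝒪_v`; the entries of `ι(α, z)` are `α`, `z σ(α) α⁻¹`, `σ(α)⁻¹` with `|σ(α)|_w = |α|_w` and `|z|_w = 1`. [cite: Rogawski1990, §12.7 L. 12.7.2 (proof) p. 193; §12.2 p. 173]
[cite: PlatonovRapinchuk1994, §5.1] -/
theorem torusChart_mem_cmLocalIntegralLevel_iff (m : (LocalRing L v)ˣ × ↥(normOneUnits (conjLocal L (IsCMField.complexConj L) v))) :
    ((torusChart L v m : ↥(cmBorelTriple L 3 v).M) : ↥(unitaryGroupOfForm (conjLocal L (IsCMField.complexConj L) v) (cmLocalForm L 3 v))) ∈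
        cmLocalIntegralLevel L 3 (Matrix.of fun i j : Fin 3 => if i.val + j.val + 1 = 3 then (1 : L) else 0) v ↔
      m ∈ ((Submonoid.pi Set.univ (fun w : PlacesOver L v => (w.1.adicCompletionIntegers L).toSubring.toSubmonoid)).units.prod
        (⊤ : Subgroup ↥(normOneUnits (conjLocal L (IsCMField.complexConj L) v)))) := by
  rw [mem_cmLocalIntegralLevel_iff_forall_v_le_one, Subgroup.mem_prod, mem_unitsIntegers_iff]
  -- valuations of the three chart entries
  have hσv : ∀ (u : (LocalRing L v)ˣ) (w : PlacesOver L v),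
      Valued.v (((Units.map ((conjLocal L (IsCMField.complexConj L) v : LocalRing L v →+* LocalRing L v) : LocalRing L v →* LocalRing L v) u :
        (LocalRing L v)ˣ) : LocalRing L v) w) = Valued.v ((u : LocalRing L v) w) := fun u w => by
    rw [Units.coe_map, MonoidHom.coe_coe, conjLocal_apply_eq_of_smul_eq (IsCMField.complexConj L) (IsCMField.complexConj_ne_one L) v w (hns w),
      valued_galAdicCompletionMap]
  have hz : ∀ w : PlacesOver L v, Valued.v ((((m.2 : (LocalRing L v)ˣ)) : LocalRing L v) w) = 1 :=
    valued_apply_eq_one_of_mem_normOneUnits L v hns m.2.2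
  have hinv : ∀ (u : (LocalRing L v)ˣ) (w : PlacesOver L v), Valued.v ((((u⁻¹ : (LocalRing L v)ˣ)) : LocalRing L v) w) = (Valued.v ((u : LocalRing L v) w))⁻¹ :=
    fun u w => by
      have hprod : Valued.v (((u⁻¹ : (LocalRing L v)ˣ) : LocalRing L v) w) * Valued.v ((u : LocalRing L v) w) = 1 := by
        rw [← map_mul, ← Pi.mul_apply, Units.inv_mul, Pi.one_apply, map_one]
      exact eq_inv_of_mul_eq_one_left hprod
  -- the matrices of `ι m` and of its inverse are diagonal with entries `torusChartEntries m` and their inverses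
  have hcoe : (((torusChart L v m : ↥(cmBorelTriple L 3 v).M) : ↥(unitaryGroupOfForm (conjLocal L (IsCMField.complexConj L) v) (cmLocalForm L 3 v))) :
      GL (Fin 3) (LocalRing L v)).val = Matrix.diagonal fun k => ((torusChartEntries L v m k : (LocalRing L v)ˣ) : LocalRing L v) := by
    rw [coe_torusChart]
    exact coe_glDiagonal _ _ _
  have hcoeinv : ((((torusChart L v m : ↥(cmBorelTriple L 3 v).M) : ↥(unitaryGroupOfForm (conjLocal L (IsCMField.complexConj L) v) (cmLocalForm L 3 v)))⁻¹ :
      ↥(unitaryGroupOfForm (conjLocal L (IsCMField.complexConj L) v) (cmLocalForm L 3 v))) : GL (Fin 3) (LocalRing L v)).val =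
      Matrix.diagonal fun k => (((torusChartEntries L v m k)⁻¹ : (LocalRing L v)ˣ) : LocalRing L v) := by
    rw [Subgroup.coe_inv, coe_torusChart, ← map_inv]
    exact coe_glDiagonal _ _ _
  -- the three entries' valuations in terms of `|α|_w`
  have he0 : ∀ w, Valued.v (((torusChartEntries L v m 0 : (LocalRing L v)ˣ) : LocalRing L v) w) = Valued.v ((m.1 : LocalRing L v) w) := fun w => rfl
  have he2 : ∀ w, Valued.v (((torusChartEntries L v m 2 : (LocalRing L v)ˣ) : LocalRing L v) w) = (Valued.v ((m.1 : LocalRing L v) w))⁻¹ := fun w => by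
    show Valued.v ((((Units.map ((conjLocal L (IsCMField.complexConj L) v : LocalRing L v →+* LocalRing L v) : LocalRing L v →* LocalRing L v) m.1)⁻¹ :
      (LocalRing L v)ˣ) : LocalRing L v) w) = _
    rw [hinv, hσv]
  have he1 : ∀ w, Valued.v ((m.1 : LocalRing L v) w) = 1 → Valued.v (((torusChartEntries L v m 1 : (LocalRing L v)ˣ) : LocalRing L v) w) = 1 := fun w hα => by
    show Valued.v ((((m.2 : (LocalRing L v)ˣ) * Units.map ((conjLocal L (IsCMField.complexConj L) v : LocalRing L v →+* LocalRing L v) :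
        LocalRing L v →* LocalRing L v) m.1 * m.1⁻¹ : (LocalRing L v)ˣ) : LocalRing L v) w) = 1
    rw [Units.val_mul, Units.val_mul, Pi.mul_apply, Pi.mul_apply, map_mul, map_mul, hz, hσv, hinv, hα, inv_one, one_mul, one_mul]
  simp only [hcoe, hcoeinv]
  constructor
  · rintro ⟨h1, h2⟩
    refine ⟨fun w => le_antisymm ?_ ?_, Subgroup.mem_top _⟩
    · have h := h1 0 0 w
      rw [Matrix.diagonal_apply_eq, he0] at h
      exact h
    · have h := h2 0 0 w
      rw [Matrix.diagonal_apply_eq, hinv, he0] at h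
      have hne : Valued.v ((m.1 : LocalRing L v) w) ≠ 0 := by
        rw [Valuation.ne_zero_iff]
        have h1w : (((m.1⁻¹ : (LocalRing L v)ˣ) : LocalRing L v) * (m.1 : LocalRing L v)) w = 1 := by
          rw [Units.inv_mul]; rfl
        rw [Pi.mul_apply] at h1w
        exact right_ne_zero_of_mul_eq_one h1w
      exact (inv_le_one₀ (zero_lt_iff.2 hne)).1 h
  · rintro ⟨hα, -⟩
    have hent : ∀ (i : Fin 3) (w : PlacesOver L v), Valued.v (((torusChartEntries L v m i : (LocalRing L v)ˣ) : LocalRing L v) w) = 1 := by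
      intro i w
      fin_cases i
      · exact (he0 w).trans (hα w)
      · exact he1 w (hα w)
      · exact (he2 w).trans (by rw [hα w, inv_one])
    refine ⟨fun i j w => ?_, fun i j w => ?_⟩
    · by_cases hij : i = j
      · subst hij
        rw [Matrix.diagonal_apply_eq]
        exact (hent i w).le
      · rw [Matrix.diagonal_apply_ne _ hij, Pi.zero_apply, map_zero]
        exact zero_le
    · by_cases hij : i = j
      · subst hij
        rw [Matrix.diagonal_apply_eq, hinv, hent i w, inv_one]
      · rw [Matrix.diagonal_apply_ne _ hij, Pi.zero_apply, map_zero]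
        exact zero_le

include hns in
/-- **THE CALIBRATION CONSTANT**: `(ι_* μM)(T ∩ K_v) = μM(M_c)` — the set is the one in the constant `μ_T(T ∩ K_v)⁻¹` of ★
`smoothTrace_cmPrincipalSeries_map_symm_eq_inv_mul_integral`, token for token; with `μ_T := ι_* μM` that constant is `μM(M_c)⁻¹`, the calibration of ★ `torusTransform`.
[cite: Rogawski1990, §12.7 L. 12.7.2 (proof) p. 193; §4.9 (4.9.4) p. 56] -/
theorem map_torusChart_real_level_eq
    [MeasurableSpace ((LocalRing L v)ˣ × ↥(normOneUnits (conjLocal L (IsCMField.complexConj L) v)))]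
    [BorelSpace ((LocalRing L v)ˣ × ↥(normOneUnits (conjLocal L (IsCMField.complexConj L) v)))]
    [MeasurableSpace ↥(unitaryGroupOfForm (conjLocal L (IsCMField.complexConj L) v) (cmLocalForm L 3 v))]
    [BorelSpace ↥(unitaryGroupOfForm (conjLocal L (IsCMField.complexConj L) v) (cmLocalForm L 3 v))]
    (μM : Measure ((LocalRing L v)ˣ × ↥(normOneUnits (conjLocal L (IsCMField.complexConj L) v)))) :
    (μM.map (torusChart L v)).real {t : ↥(cmBorelTriple L 3 v).M |
        (t : ↥(unitaryGroupOfForm (conjLocal L (IsCMField.complexConj L) v) (cmLocalForm L 3 v))) ∈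
          cmLocalIntegralLevel L 3 (Matrix.of fun i j : Fin 3 => if i.val + j.val + 1 = 3 then (1 : L) else 0) v} =
      μM.real ((((Submonoid.pi Set.univ (fun w : PlacesOver L v => (w.1.adicCompletionIntegers L).toSubring.toSubmonoid)).units.prod
        (⊤ : Subgroup ↥(normOneUnits (conjLocal L (IsCMField.complexConj L) v)))) :
          Subgroup ((LocalRing L v)ˣ × ↥(normOneUnits (conjLocal L (IsCMField.complexConj L) v)))) :
            Set ((LocalRing L v)ˣ × ↥(normOneUnits (conjLocal L (IsCMField.complexConj L) v)))) := by
  have hopen : IsOpen {t : ↥(cmBorelTriple L 3 v).M |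
      (t : ↥(unitaryGroupOfForm (conjLocal L (IsCMField.complexConj L) v) (cmLocalForm L 3 v))) ∈
        cmLocalIntegralLevel L 3 (Matrix.of fun i j : Fin 3 => if i.val + j.val + 1 = 3 then (1 : L) else 0) v} :=
    (isCompact_isOpen_cmLocalIntegralLevel L 3 (Matrix.of fun i j : Fin 3 => if i.val + j.val + 1 = 3 then (1 : L) else 0) v).2.preimage
      continuous_subtype_val
  rw [measureReal_def, measureReal_def, Measure.map_apply (continuous_torusChart L v).measurable hopen.measurableSet]
  congr 1
  congr 1
  ext m
  rw [Set.mem_preimage, Set.mem_setOf_eq, torusChart_mem_cmLocalIntegralLevel_iff L v hns m, SetLike.mem_coe]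

end Summit.HodgeConjecture.HodgeConjecture.Cruxes.H413.F0P3cStCharTSTorusChartIso

end
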